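import Mathlib
import HarnessLib

/-!
# Far-side channel estimate: two lemmas of the assembly

Analysis/PDE support file (everything proved, no definitions).
* `inverseSquareTail_sandwich`: if `|V − Lι²| ≤ A x^{−5/2}` beyond `y₀ ≥ 1` (`ι = 1/x` there,
  `L ≥ 2`), then `Lι² ≤ 2V` and `V ≤ 2Lι²` beyond `max y₀ (|A|+1)²` — the comparability of the true
  and the exact potential on far half-lines;
* `ENNReal.liminf_le_two_mul_of_le`: if `u ≤ 2v + 2w` pointwise with `w → 0` along a filter, then
  `liminf u ≤ 2 liminf v` (`ℝ≥0∞`-valued) — subtracting a non-radiating function at most doubles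
  the channel energies.
Route PhotonSphereChannels, `FixedModeChannels`, far side (stmt-FinalStateConjecture-10048).
Folklore.
-/

noncomputable section

namespace Literature.Analysis.PDE

open Filter Topology

/-- **Comparability of the true and the exact potential far out.** See the module docstring.
[folklore] -/
theorem inverseSquareTail_sandwich {V ι : ℝ → ℝ} {L A y₀ : ℝ} (hL : 2 ≤ L) (hy₀ : 1 ≤ y₀)
    (hιeq : ∀ x : ℝ, 1 / 2 ≤ x → ι x = x⁻¹)
    (hVb : ∀ x, y₀ ≤ x → |V x - L * ι x ^ 2| ≤ A * x ^ (-(5 / 2 : ℝ))) {x : ℝ}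
    (hx : max y₀ ((|A| + 1) ^ 2) ≤ x) :
    L * ι x ^ 2 ≤ 2 * V x ∧ V x ≤ 2 * (L * ι x ^ 2) := by
  have hxy : y₀ ≤ x := (le_max_left _ _).trans hx
  have hxA : (|A| + 1) ^ 2 ≤ x := (le_max_right _ _).trans hx
  have hx1 : 1 ≤ x := hy₀.trans hxy
  have hx0 : 0 < x := by linarith
  have hA1 : 0 < |A| + 1 := by positivity
  -- `w = x^{-2} = ι²`, `u = x^{-1/2} ≤ (|A|+1)⁻¹`
  have hw : ι x ^ 2 = x ^ (-(2 : ℝ)) := by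
    rw [hιeq x (by linarith), Real.rpow_neg hx0.le, Real.rpow_two, inv_pow]
  have hw0 : 0 < x ^ (-(2 : ℝ)) := Real.rpow_pos_of_pos hx0 _
  have hu : x ^ (-(1 / 2 : ℝ)) ≤ (|A| + 1)⁻¹ := by
    have h1 : x ^ (-(1 / 2 : ℝ)) ≤ ((|A| + 1) ^ 2) ^ (-(1 / 2 : ℝ)) :=
      Real.rpow_le_rpow_of_nonpos (by positivity) hxA (by norm_num)
    have h2 : ((|A| + 1) ^ 2) ^ (-(1 / 2 : ℝ)) = (|A| + 1)⁻¹ := by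
      rw [← Real.rpow_natCast (|A| + 1) 2, ← Real.rpow_mul hA1.le]
      norm_num
      exact Real.rpow_neg_one _
    rw [h2] at h1
    exact h1
  have hu0 : 0 ≤ x ^ (-(1 / 2 : ℝ)) := Real.rpow_nonneg hx0.le _
  have hsplit : x ^ (-(5 / 2 : ℝ)) = x ^ (-(2 : ℝ)) * x ^ (-(1 / 2 : ℝ)) := by
    rw [← Real.rpow_add hx0]; norm_num
  -- `|A| x^{-5/2} ≤ (L/2) x^{-2}`
  have hkey : |A| * x ^ (-(5 / 2 : ℝ)) ≤ x ^ (-(2 : ℝ)) := by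
    rw [hsplit]
    have h1 : |A| * x ^ (-(1 / 2 : ℝ)) ≤ |A| * (|A| + 1)⁻¹ :=
      mul_le_mul_of_nonneg_left hu (abs_nonneg A)
    have h2 : |A| * (|A| + 1)⁻¹ ≤ 1 := by
      rw [← div_eq_mul_inv, div_le_one hA1]; linarith
    calc |A| * (x ^ (-(2 : ℝ)) * x ^ (-(1 / 2 : ℝ))) = x ^ (-(2 : ℝ)) * (|A| * x ^ (-(1 / 2 : ℝ))) := by
          ring
      _ ≤ x ^ (-(2 : ℝ)) * 1 := mul_le_mul_of_nonneg_left (h1.trans h2) hw0.le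
      _ = x ^ (-(2 : ℝ)) := mul_one _
  have hb := hVb x hxy
  have hb' : |V x - L * ι x ^ 2| ≤ x ^ (-(2 : ℝ)) := by
    refine hb.trans (le_trans ?_ hkey)
    exact mul_le_mul_of_nonneg_right (le_abs_self A) (Real.rpow_nonneg hx0.le _)
  rw [hw] at hb' ⊢
  have h1 := (abs_le.1 hb').1
  have h2 := (abs_le.1 hb').2
  constructor <;> nlinarith

/-- **`liminf u ≤ 2 liminf v` from `u ≤ 2v + 2w`, `w → 0`.** [folklore] -/
theorem ENNReal.liminf_le_two_mul_of_le {F : Filter ℝ} [F.NeBot] {u v w : ℝ → ENNReal}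
    (h : ∀ t, u t ≤ 2 * v t + 2 * w t) (hw : Tendsto w F (𝓝 0)) :
    liminf u F ≤ 2 * liminf v F := by
  refine ENNReal.le_of_forall_pos_le_add fun ε hε _ => ?_
  have hε0 : (0 : ENNReal) < (ε : ENNReal) / 2 :=
    ENNReal.half_pos (by exact_mod_cast hε.ne')
  have hev : ∀ᶠ t in F, w t ≤ (ε : ENNReal) / 2 :=
    (hw.eventually_mem (Iic_mem_nhds hε0)).mono fun t ht => ht
  have hmono : Monotone fun x : ENNReal => 2 * x + ε := fun x y hxy => by
    dsimp only; gcongr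
  have hcont : Continuous fun x : ENNReal => 2 * x + ε :=
    (ENNReal.continuous_const_mul (by norm_num)).add continuous_const
  have key : liminf (fun t => 2 * v t + ε) F = 2 * liminf v F + ε :=
    (hmono.map_liminf_of_continuousAt (F := F) v hcont.continuousAt).symm
  calc liminf u F ≤ liminf (fun t => 2 * v t + (ε : ENNReal)) F := by
        refine liminf_le_liminf (hev.mono fun t ht => (h t).trans ?_)
        calc 2 * v t + 2 * w t ≤ 2 * v t + 2 * ((ε : ENNReal) / 2) := by gcongr
          _ = 2 * v t + ε := by rw [two_mul ((ε : ENNReal) / 2), ENNReal.add_halves]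
    _ = 2 * liminf v F + ε := key

end Literature.Analysis.PDE
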